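import Summits.BirchSwinnertonDyer.BirchSwinnertonDyer.Theorems.InertBadSignedBranchesInertBadAtThreeQuarticCleanAssemblyCRT
import Summits.BirchSwinnertonDyer.BirchSwinnertonDyer.Theorems.InertBadSignedBranchesInertBadAtThreeQuarticTorsionIntegrality
import Summits.BirchSwinnertonDyer.BirchSwinnertonDyer.Theorems.InertBadSignedBranchesInertBadAtThreeQuarticModelPeriods
import Summits.BirchSwinnertonDyer.BirchSwinnertonDyer.Theorems.InertBadSignedBranchesInertBadAtThreeQuarticModel
import Summits.BirchSwinnertonDyer.BirchSwinnertonDyer.Theorems.EdixhovenFibreFiveSevenStarredOptimalManinUnitFiveSevenValueExit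
import Mathlib.NumberTheory.GaussSum
import Mathlib.NumberTheory.DirichletCharacter.Basic
import Mathlib.NumberTheory.LSeries.Basic
import HarnessLib

/-!
# STUB-PLAN P6 (assembly), part B — `3`-integrality bookkeeping: the `f`-free odd twisted-value statement for the quartic
# models `y² = x³ + Ax` from the theta dictionary

Summit `BirchSwinnertonDyer`, crux `InertBadAtThree` (stmt-BirchSwinnertonDyer-19225; K8 `InertBadSignedBranches` r4 / BED
`BiquadraticEisensteinDescent` r5), line of record `Cruxes/InertBadAtThree/Lines/rubin_e1_inert_three.lean` v5 (lead `bsd-line-ibd-p1`),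
registered stub `stub_plainOddNeronIntegralThreeQuartic`; STUB-PLAN `Cruxes/InertBadAtThree/STUB-PLAN-neronIntegralThreeQuartic-bsd-idea-18-g8.md`
piece **P6 `stub_clean_of_dictionary`**, second half (odd branch, which is all the v5 stub needs). Lead bsd-line-ibd-p1 g7
(`--supports 19225`, helper). Part A = `…QuarticCleanAssemblyCRT` (CRT regrouping into the `χ₄^k`-weighted `3`-torsion sums `R_k`).

* §5 `torsionSum_threeIntegral` / `sum_torsion_threeIntegral` — for `k = 1, 2, 3`, `3 ∤ M'`, `Ψ'` with algebraic-integer values: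
  `s · Σ_{b mod M'} Ψ'(b) R_k(β conj(b)/M') / (ϖ₀ · 3^{(4−k)/4}) ∈ ℤ̄` for some `3 ∤ s` (width seat bed-w1 g7's P6a/P6b/P6c
  `…QuarticTorsionIntegrality.quarticSum_threeIntegral` / `kappaSum_threeIntegral` / `quarticConjSum_threeIntegral` termwise, `R_k = 0` at
  lattice points, product of the denominators);
* §6 `thetaLFunction_one_eq_sum_torsion` — `Θ-L_{3M'}(conj(q)^k Ψ')(1) = (3M')⁻¹ Σ_b Ψ'(b) R_k(β conj(b)/M')` (finite formula
  `GaussianLattice.thetaLFunction_one_eq_sum_kroneckerE₁` + Part A);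
* §7 ★ **`oddLValue_quartic_of_dictionary`** — for `A ≠ 0`, `1 ≤ k ≤ 3`, `3^k ∣ A`, `(3, M') = 1`, `Ψ'` periodic modulo `M'` with
  algebraic-integer values and the THETA DICTIONARY hypothesis «`Σ χ̄(n)a_n(E_A)n⁻ˢ = ¼ Θ-L_{3M'}(conj(q)^k Ψ')(s)` on `re s > 2`» (`q` the
  `(·/3)₄` table, hypothesis shape `hq` of Part A; = STUB-PLAN P1b for the model): the `f`-free odd statement of `…QuarticValueExit` /
  `…QuarticModel.LValueOdd_of_quarticModel` for `E_A = ⟨0,0,0,A,0⟩` at `p = 3` — the entire `L = ¼ Θ-L` has `s·τ(χ)·L(1)/(i·Ω⁻(E_A)) ∈ ℤ̄`,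
  `3 ∤ s`. Period side: bed-w3 g8's `…QuarticModelPeriods.imaginaryPeriodRat_quartic_of_neg/_pos` (`Ω⁻(E_A) = c·ϖ₀·|A|^{−1/4}`,
  `c ∈ {1, √2}`); the powers of `3` cancel exactly: `|A|^{1/4} = 3^{k/4}A₁^{1/4}`, `3^{k/4}·3^{(4−k)/4} = 3` against the `1/3` of `1/(3M')`.

What remains for the registered stub after this file: the dictionary P1b itself (bed-w4 g9 / bed-w2 g9, ideator plan
`QUARTIC_DICTIONARY_PLAN_bsd_idea_18_g9.lean`) and the V-level closer (model `C • V = E_A` with `v₃(u_C) = 0`, `1 ≤ v₃(A) ≤ 3`: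
bed-w3 g8's `…QuarticModelKRange` + `LValueOdd_of_smul` + `…QuarticValueExit.plainOdd_of_LValue`).
HONEST FRAMING: conditional on the dictionary hypothesis; nothing here proves the stub, the crux or BSD. No definitions, no named
facts, no `sorry`; axioms standard.
-/

set_option linter.dupNamespace false
set_option autoImplicit false

noncomputable section

open scoped ComplexConjugate
open Complex PeriodPair
open Literature.NumberTheory.EllipticCurves Literature.NumberTheory.EllipticCurves.GaussianLattice
open Literature.NumberTheory.LFunctions Literature.NumberTheory.LFunctions.GaussianTheta

namespace Summit.BirchSwinnertonDyer.BirchSwinnertonDyer.Theorems.InertBadSignedBranchesInertBadAtThreeQuarticCleanAssembly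

/-! ## §5 Termwise `3`-integrality of the regrouped sum -/

section Integrality

open Summit.BirchSwinnertonDyer.BirchSwinnertonDyer.Theorems.InertBadSignedBranchesInertBadAtThreeQuarticTorsionIntegrality

/-- `E₁*(l + v) + E₁*(l − v) = 0` for `l ∈ Λ` (oddness and periodicity). [folklore] -/
theorem kroneckerE₁_add_add_kroneckerE₁_sub_of_mem {l : ℂ} (hl : l ∈ (ofUpperHalfPlane UpperHalfPlane.I).lattice) (v : ℂ) :
    kroneckerE₁ (l + v) + kroneckerE₁ (l - v) = 0 := by
  rw [show l + v = v + l by ring, show l - v = -v + l by ring, kroneckerE₁_add_of_mem _ hl,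
    kroneckerE₁_add_of_mem _ hl, kroneckerE₁_neg]
  ring

/-- `√3 = 3^{2/4}` in `ℂ` (principal branch). [folklore] -/
theorem sqrt_three_eq_cpow : ((Real.sqrt 3 : ℝ) : ℂ) = (3 : ℂ) ^ ((((4 - 2 : ℕ) : ℂ)) / 4) := by
  rw [Real.sqrt_eq_rpow, Complex.ofReal_cpow (by norm_num : (0:ℝ) ≤ 3)]
  push_cast
  norm_num

/-- **Termwise `3`-integrality of `R_k`** (`k = 1, 2, 3`): for every `w` with `M' w ∈ Λ`, `3 ∤ M'`, there is `s`, `3 ∤ s`, with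
`s · R_k(w)/(ϖ₀ · 3^{(4−k)/4})` an algebraic integer — P6a/P6b/P6c of `…QuarticTorsionIntegrality` for `w ∉ Λ`, and `R_k(w) = 0`
for `w ∈ Λ`. [folklore] -/
theorem torsionSum_threeIntegral {k : ℕ} (hk1 : 1 ≤ k) (hk3 : k ≤ 3) {M' : ℕ} (h3 : ¬ 3 ∣ M') {w : ℂ}
    (hw : ((M' : ℂ) * w) ∈ (ofUpperHalfPlane UpperHalfPlane.I).lattice) :
    ∃ s : ℕ, ¬ 3 ∣ s ∧ IsIntegral ℤ ((s : ℂ) *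
      ((kroneckerE₁ (w + 1 / 3) + kroneckerE₁ (w - 1 / 3)) +
          (-1 : ℂ) ^ k * (kroneckerE₁ (w + I / 3) + kroneckerE₁ (w - I / 3)) +
          I ^ k * (kroneckerE₁ (w + (1 - I) / 3) + kroneckerE₁ (w - (1 - I) / 3)) +
          (-I) ^ k * (kroneckerE₁ (w + (1 + I) / 3) + kroneckerE₁ (w - (1 + I) / 3))) /
        ((((Real.Gamma (1 / 4) ^ 2 / (2 * Real.sqrt (2 * Real.pi))) : ℝ) : ℂ) * (3 : ℂ) ^ (((4 - k : ℕ) : ℂ) / 4))) := by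
  by_cases hwΛ : w ∈ (ofUpperHalfPlane UpperHalfPlane.I).lattice
  · refine ⟨1, by norm_num, ?_⟩
    rw [kroneckerE₁_add_add_kroneckerE₁_sub_of_mem hwΛ, kroneckerE₁_add_add_kroneckerE₁_sub_of_mem hwΛ,
      kroneckerE₁_add_add_kroneckerE₁_sub_of_mem hwΛ, kroneckerE₁_add_add_kroneckerE₁_sub_of_mem hwΛ]
    simp only [mul_zero, add_zero, zero_div]
    exact isIntegral_zero
  have hI3 : I ^ 3 = -I := by rw [pow_succ, I_sq]; ring
  interval_cases k
  · obtain ⟨s, hs, hint⟩ := quarticSum_threeIntegral hwΛ hw h3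
    refine ⟨s, hs, ?_⟩
    convert hint using 2
    · simp only [pow_one]; ring
    · norm_num
  · obtain ⟨s, hs, hint⟩ := kappaSum_threeIntegral hwΛ hw h3
    refine ⟨s, hs, ?_⟩
    rw [threeTorsionTwistedSum_def, sqrt_three_eq_cpow] at hint
    convert hint using 2
    simp only [neg_sq, I_sq]; ring
  · obtain ⟨s, hs, hint⟩ := quarticConjSum_threeIntegral hwΛ hw h3
    refine ⟨s, hs, ?_⟩
    have hnI3 : (-I) ^ 3 = I := by rw [neg_pow, hI3]; norm_num
    convert hint using 2
    · rw [hnI3, hI3]; norm_num; left; ring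
    · norm_num

/-- `M' · (β conj(b)/M') = β conj(b) ∈ Λ` for a Gaussian integer `b`. [folklore] -/
theorem natCast_mul_div_mem_lattice {M' : ℕ} [NeZero M'] (β : ℤ) (b : GaussianInt) :
    ((M' : ℂ) * ((β : ℂ) * conj ((b : GaussianInt) : ℂ) / M')) ∈ (ofUpperHalfPlane UpperHalfPlane.I).lattice := by
  have hM : (M' : ℂ) ≠ 0 := Nat.cast_ne_zero.mpr (NeZero.ne M')
  rw [mul_div_cancel₀ _ hM, ← GaussianInt.toComplex_star, ← map_intCast GaussianInt.toComplex β, ← map_mul]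
  exact toComplex_mem_lattice _

/-- **`3`-integrality of the regrouped sum** (`k = 1, 2, 3`; `3 ∤ M'`; `Ψ` with algebraic-integer values): there is `s`, `3 ∤ s`,
with `s · Σ_{b mod M'} Ψ(b) R_k(β conj(b)/M') / (ϖ₀ · 3^{(4−k)/4})` an algebraic integer (termwise, product of the denominators).
[folklore] -/
theorem sum_torsion_threeIntegral {k : ℕ} (hk1 : 1 ≤ k) (hk3 : k ≤ 3) {M' : ℕ} [NeZero M'] (h3 : ¬ 3 ∣ M') (β : ℤ)
    (Ψ : GaussianInt → ℂ) (hΨ : ∀ x : GaussianInt, IsIntegral ℤ (Ψ x)) :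
    ∃ s : ℕ, ¬ 3 ∣ s ∧ IsIntegral ℤ ((s : ℂ) *
      (∑ b : ZMod M' × ZMod M', Ψ (rep M' b 0) *
        ((kroneckerE₁ ((β : ℂ) * conj ((rep M' b 0 : GaussianInt) : ℂ) / M' + 1 / 3) +
            kroneckerE₁ ((β : ℂ) * conj ((rep M' b 0 : GaussianInt) : ℂ) / M' - 1 / 3)) +
          (-1 : ℂ) ^ k * (kroneckerE₁ ((β : ℂ) * conj ((rep M' b 0 : GaussianInt) : ℂ) / M' + I / 3) +
            kroneckerE₁ ((β : ℂ) * conj ((rep M' b 0 : GaussianInt) : ℂ) / M' - I / 3)) +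
          I ^ k * (kroneckerE₁ ((β : ℂ) * conj ((rep M' b 0 : GaussianInt) : ℂ) / M' + (1 - I) / 3) +
            kroneckerE₁ ((β : ℂ) * conj ((rep M' b 0 : GaussianInt) : ℂ) / M' - (1 - I) / 3)) +
          (-I) ^ k * (kroneckerE₁ ((β : ℂ) * conj ((rep M' b 0 : GaussianInt) : ℂ) / M' + (1 + I) / 3) +
            kroneckerE₁ ((β : ℂ) * conj ((rep M' b 0 : GaussianInt) : ℂ) / M' - (1 + I) / 3)))) /
        ((((Real.Gamma (1 / 4) ^ 2 / (2 * Real.sqrt (2 * Real.pi))) : ℝ) : ℂ) * (3 : ℂ) ^ (((4 - k : ℕ) : ℂ) / 4))) := by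
  classical
  -- abbreviations
  set ρ : ℂ := (((Real.Gamma (1 / 4) ^ 2 / (2 * Real.sqrt (2 * Real.pi))) : ℝ) : ℂ) * (3 : ℂ) ^ (((4 - k : ℕ) : ℂ) / 4)
    with hρ
  set w : ZMod M' × ZMod M' → ℂ := fun b ↦ (β : ℂ) * conj ((rep M' b 0 : GaussianInt) : ℂ) / M' with hw
  set R : ZMod M' × ZMod M' → ℂ := fun b ↦
    (kroneckerE₁ (w b + 1 / 3) + kroneckerE₁ (w b - 1 / 3)) +
      (-1 : ℂ) ^ k * (kroneckerE₁ (w b + I / 3) + kroneckerE₁ (w b - I / 3)) +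
      I ^ k * (kroneckerE₁ (w b + (1 - I) / 3) + kroneckerE₁ (w b - (1 - I) / 3)) +
      (-I) ^ k * (kroneckerE₁ (w b + (1 + I) / 3) + kroneckerE₁ (w b - (1 + I) / 3)) with hR
  have hterm : ∀ b : ZMod M' × ZMod M', ∃ s : ℕ, ¬ 3 ∣ s ∧ IsIntegral ℤ ((s : ℂ) * R b / ρ) := fun b ↦
    torsionSum_threeIntegral hk1 hk3 h3 (natCast_mul_div_mem_lattice β (rep M' b 0))
  choose s hs using hterm
  refine ⟨∏ b, s b, ?_, ?_⟩
  · rw [Prime.dvd_finsetProd_iff Nat.prime_three.prime]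
    rintro ⟨b, -, hb⟩
    exact (hs b).1 hb
  · have key : ((∏ b, s b : ℕ) : ℂ) * (∑ b, Ψ (rep M' b 0) * R b) / ρ =
        ∑ b, ((∏ b' ∈ Finset.univ.erase b, s b' : ℕ) : ℂ) * Ψ (rep M' b 0) * ((s b : ℂ) * R b / ρ) := by
      rw [Finset.mul_sum, Finset.sum_div]
      refine Finset.sum_congr rfl fun b _ ↦ ?_
      rw [← Finset.mul_prod_erase Finset.univ s (Finset.mem_univ b)]
      push_cast
      ring
    show IsIntegral ℤ (((∏ b, s b : ℕ) : ℂ) * (∑ b, Ψ (rep M' b 0) * R b) / ρ)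
    rw [key]
    refine IsIntegral.sum _ fun b _ ↦ ?_
    refine IsIntegral.mul (IsIntegral.mul ?_ (hΨ _)) (hs b).2
    simpa using isIntegral_algebraMap (R := ℤ) (A := ℂ) (x := ((∏ b' ∈ Finset.univ.erase b, s b' : ℕ) : ℤ))

end Integrality

/-! ## §6 The theta `L`-value at `s = 1` through the regrouped sum -/

section LValue

variable {M' : ℕ} [NeZero M'] [NeZero (3 * M')]
variable {q : GaussianInt → ℂ}
  (hq : ∀ x : GaussianInt, q x =
    if (3 : ℤ) ∣ x.re ∧ (3 : ℤ) ∣ x.im then 0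
    else if (3 : ℤ) ∣ x.im then 1
    else if (3 : ℤ) ∣ x.re then -1
    else if (3 : ℤ) ∣ x.re - x.im then -I
    else I)

include hq

omit [NeZero M'] [NeZero (3 * M')] in
/-- `Φ = conj(q)^k · Ψ'` is periodic modulo `3M'`. [folklore] -/
theorem phi_periodic (Ψ : GaussianInt → ℂ) (hΨ : ∀ x y : GaussianInt, Ψ (x + M' * y) = Ψ x) (k : ℕ) (x y : GaussianInt) :
    (conj (q (x + (3 * M' : ℕ) * y))) ^ k * Ψ (x + (3 * M' : ℕ) * y) = (conj (q x)) ^ k * Ψ x := by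
  rw [show x + ((3 * M' : ℕ) : GaussianInt) * y = x + 3 * ((M' : GaussianInt) * y) by push_cast; ring,
    table_add_three_mul hq, show x + 3 * ((M' : GaussianInt) * y) = x + (M' : GaussianInt) * (3 * y) by ring, hΨ]

/-- **The theta `L`-value at `s = 1` of the quartic-twist coefficient**: for `(3, M') = 1`, `αM' + 3β = 1`, `Ψ'` periodic modulo `M'`
and `k ≥ 1`, `Θ-L_{3M'}(conj(q)^k Ψ')(1) = (3M')⁻¹ Σ_{b mod M'} Ψ'(b) R_k(β conj(b)/M')` (finite formula + CRT regrouping).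
[cite: Rubin1999, Prop. 7.15] -/
theorem thetaLFunction_one_eq_sum_torsion (h3 : Nat.Coprime 3 M') {α β : ℤ} (hαβ : α * M' + 3 * β = 1)
    (Ψ : GaussianInt → ℂ) (hΨ : ∀ x y : GaussianInt, Ψ (x + M' * y) = Ψ x) {k : ℕ} (hk : k ≠ 0) :
    thetaLFunction (3 * M') (fun x ↦ (conj (q x)) ^ k * Ψ x) 1 =
      ((3 * M' : ℕ) : ℂ)⁻¹ * ∑ b : ZMod M' × ZMod M', Ψ (rep M' b 0) *
        ((kroneckerE₁ ((β : ℂ) * conj ((rep M' b 0 : GaussianInt) : ℂ) / M' + 1 / 3) +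
            kroneckerE₁ ((β : ℂ) * conj ((rep M' b 0 : GaussianInt) : ℂ) / M' - 1 / 3)) +
          (-1 : ℂ) ^ k * (kroneckerE₁ ((β : ℂ) * conj ((rep M' b 0 : GaussianInt) : ℂ) / M' + I / 3) +
            kroneckerE₁ ((β : ℂ) * conj ((rep M' b 0 : GaussianInt) : ℂ) / M' - I / 3)) +
          I ^ k * (kroneckerE₁ ((β : ℂ) * conj ((rep M' b 0 : GaussianInt) : ℂ) / M' + (1 - I) / 3) +
            kroneckerE₁ ((β : ℂ) * conj ((rep M' b 0 : GaussianInt) : ℂ) / M' - (1 - I) / 3)) +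
          (-I) ^ k * (kroneckerE₁ ((β : ℂ) * conj ((rep M' b 0 : GaussianInt) : ℂ) / M' + (1 + I) / 3) +
            kroneckerE₁ ((β : ℂ) * conj ((rep M' b 0 : GaussianInt) : ℂ) / M' - (1 + I) / 3))) := by
  rw [thetaLFunction_one_eq_sum_kroneckerE₁ (3 * M') _ (phi_periodic hq Ψ hΨ k),
    ← sum_classes_three_mul_eq_sum_torsion hq h3 hαβ Ψ hΨ hk]

end LValue

/-! ## §7 Period bookkeeping and the `f`-free odd statement for the model `y² = x³ + Ax` -/

section Final

/-- `|A|^{1/4} = 3^{k/4} · A₁^{1/4}` for `|A| = 3^k A₁`, read in `ℂ` as the inverse of `|A|^{−1/4}`. [folklore] -/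
theorem inv_abs_rpow_neg_quarter {A : ℤ} {k A₁ : ℕ} (hA : A.natAbs = 3 ^ k * A₁) :
    ((((|(A : ℝ)| ^ (-(1 / 4 : ℝ)) : ℝ)) : ℂ))⁻¹ = (3 : ℂ) ^ ((k : ℂ) / 4) * ((((A₁ : ℝ) ^ (1 / 4 : ℝ) : ℝ)) : ℂ) := by
  have habs : |(A : ℝ)| = (3 : ℝ) ^ (k : ℝ) * (A₁ : ℝ) := by
    rw [← Int.cast_abs, ← Nat.cast_natAbs, hA, Real.rpow_natCast]; push_cast; ring
  rw [habs, Real.rpow_neg (by positivity), Complex.ofReal_inv, inv_inv,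
    Real.mul_rpow (by positivity) (by positivity), ← Real.rpow_mul (by norm_num), Complex.ofReal_mul,
    Complex.ofReal_cpow (by norm_num : (0 : ℝ) ≤ 3)]
  push_cast
  ring_nf

/-- `3^{k/4} · 3^{(4−k)/4} = 3` (`k ≤ 4`). [folklore] -/
theorem cpow_quarter_mul_cpow_quarter {k : ℕ} (hk : k ≤ 4) :
    (3 : ℂ) ^ ((k : ℂ) / 4) * (3 : ℂ) ^ (((4 - k : ℕ) : ℂ) / 4) = 3 := by
  rw [← Complex.cpow_add _ _ three_ne_zero, Nat.cast_sub hk,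
    show (k : ℂ) / 4 + ((4 : ℕ) - (k : ℂ)) / 4 = 1 by push_cast; ring, Complex.cpow_one]

/-- `A₁^{1/4}` is an algebraic integer for `A₁ ∈ ℕ`. [folklore] -/
theorem isIntegral_rpow_quarter (A₁ : ℕ) : IsIntegral ℤ ((((A₁ : ℝ) ^ (1 / 4 : ℝ) : ℝ)) : ℂ) := by
  refine IsIntegral.of_pow (n := 4) (by norm_num) ?_
  rw [← Complex.ofReal_pow, ← Real.rpow_mul_natCast (by positivity)]
  norm_num
  simpa using isIntegral_algebraMap (R := ℤ) (A := ℂ) (x := (A₁ : ℤ))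

/-- `√2` is an algebraic integer. [folklore] -/
theorem isIntegral_sqrt_two : IsIntegral ℤ ((Real.sqrt 2 : ℝ) : ℂ) := by
  refine IsIntegral.of_pow (n := 2) (by norm_num) ?_
  rw [← Complex.ofReal_pow, Real.sq_sqrt (by norm_num)]
  simpa using isIntegral_algebraMap (R := ℤ) (A := ℂ) (x := (2 : ℤ))

/-- The imaginary period of the model: `Ω⁻(⟨0,0,0,A,0⟩) = c · ϖ₀ · |A|^{−1/4}` with `c ∈ {1, √2}`, so `2/c` is an algebraic
integer (`…QuarticModelPeriods`). [cite: Pal2012, p. 1514] -/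
theorem exists_imaginaryPeriodRat_quartic {A : ℤ} (hA : A ≠ 0) :
    ∃ c : ℝ, c ≠ 0 ∧ IsIntegral ℤ ((2 : ℂ) / (c : ℂ)) ∧
      (⟨0, 0, 0, (A : ℚ), 0⟩ : WeierstrassCurve ℚ).imaginaryPeriodRat =
        c * ((Real.Gamma (1 / 4) ^ 2 / (2 * Real.sqrt (2 * Real.pi))) * |(A : ℝ)| ^ (-(1 / 4 : ℝ))) := by
  rcases lt_or_gt_of_ne hA with h | h
  · refine ⟨1, one_ne_zero, ?_, by rw [InertBadSignedBranchesInertBadAtThreeQuarticModelPeriods.imaginaryPeriodRat_quartic_of_neg A h, one_mul]⟩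
    simpa using isIntegral_algebraMap (R := ℤ) (A := ℂ) (x := (2 : ℤ))
  · refine ⟨Real.sqrt 2, (Real.sqrt_pos.mpr two_pos).ne', ?_,
      InertBadSignedBranchesInertBadAtThreeQuarticModelPeriods.imaginaryPeriodRat_quartic_of_pos A h⟩
    have h2 : (2 : ℂ) / (Real.sqrt 2 : ℝ) = (Real.sqrt 2 : ℝ) := by
      have hs : ((Real.sqrt 2 : ℝ) : ℂ) ^ 2 = 2 := by rw [← Complex.ofReal_pow, Real.sq_sqrt (by norm_num)]; push_cast; ring
      have hs0 : ((Real.sqrt 2 : ℝ) : ℂ) ≠ 0 := Complex.ofReal_ne_zero.mpr (Real.sqrt_pos.mpr two_pos).ne'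
      field_simp
      linear_combination (-1 : ℂ) * hs
    rw [h2]
    exact isIntegral_sqrt_two

variable {q : GaussianInt → ℂ}
  (hq : ∀ x : GaussianInt, q x =
    if (3 : ℤ) ∣ x.re ∧ (3 : ℤ) ∣ x.im then 0
    else if (3 : ℤ) ∣ x.im then 1
    else if (3 : ℤ) ∣ x.re then -1
    else if (3 : ℤ) ∣ x.re - x.im then -I
    else I)

include hq

/-- ★ **STUB-PLAN P6, odd branch, for the model `E_A : y² = x³ + Ax`.** Let `1 ≤ k ≤ 3` with `3^k ∣ A`, `(3, M') = 1`, `Ψ'` periodic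
modulo `M'` with algebraic-integer values, and suppose the THETA DICTIONARY (P1b): for `re s > 2`,
`Σ χ̄(n) a_n(E_A) n⁻ˢ = ¼ · Θ-L_{3M'}(conj(χ₄)^k · Ψ')(s)` (`χ₄ = (·/3)₄`, hypothesis shape `hq`). Then the `f`-free odd statement of
`…QuarticValueExit` holds for `E_A` at `p = 3`: the entire continuation `L = ¼ Θ-L` satisfies `s·τ(χ)·L(1)/(i·Ω⁻(E_A)) ∈ ℤ̄` for some
`3 ∤ s`. Bookkeeping: `L(1) = (12M')⁻¹ Σ_b Ψ'(b) R_k(w_b)` (§6), `R_k(w_b)/(ϖ₀3^{(4−k)/4})` is `3`-integral (§5),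
`Ω⁻(E_A) = cϖ₀|A|^{−1/4}` and `|A|^{1/4} = 3^{k/4}A₁^{1/4}`: the powers of `3` cancel exactly (`3^{k/4}·3^{(4−k)/4} = 3` against `1/3`).
[cite: Rubin1999, Prop. 7.15] [cite: MazurTateTeitelbaum1986, §I.8 (8.6)] -/
theorem oddLValue_quartic_of_dictionary (A : ℤ) (hA : A ≠ 0) {k : ℕ} (hk1 : 1 ≤ k) (hk3 : k ≤ 3) (hkA : 3 ^ k ∣ A.natAbs)
    {m : ℕ} [NeZero m] (χ : DirichletCharacter ℂ m) {M' : ℕ} [NeZero M'] [NeZero (3 * M')] (h3 : Nat.Coprime 3 M')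
    (Ψ : GaussianInt → ℂ) (hΨ : ∀ x y : GaussianInt, Ψ (x + M' * y) = Ψ x) (hΨint : ∀ x : GaussianInt, IsIntegral ℤ (Ψ x))
    (hdict : ∀ s : ℂ, 2 < s.re →
      LSeries (fun n : ℕ ↦ χ⁻¹ (n : ZMod m) * ((⟨0, 0, 0, (A : ℚ), 0⟩ : WeierstrassCurve ℚ).LFunction n : ℂ)) s =
        (1 / 4 : ℂ) * thetaLFunction (3 * M') (fun x ↦ (conj (q x)) ^ k * Ψ x) s) :
    ∃ L : ℂ → ℂ, Differentiable ℂ L ∧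
      (∀ s : ℂ, 2 < s.re →
        L s = LSeries (fun n : ℕ ↦ χ⁻¹ (n : ZMod m) * ((⟨0, 0, 0, (A : ℚ), 0⟩ : WeierstrassCurve ℚ).LFunction n : ℂ)) s) ∧
      ∃ s : ℕ, ¬ 3 ∣ s ∧ IsIntegral ℤ ((s : ℂ) * (gaussSum χ (ZMod.stdAddChar (N := m)) * L 1 /
        (Complex.I * ((⟨0, 0, 0, (A : ℚ), 0⟩ : WeierstrassCurve ℚ).imaginaryPeriodRat : ℂ)))) := by
  -- Bezout for `(3, M')`
  have h3' : ¬ 3 ∣ M' := fun h ↦ by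
    have h1 : 3 ∣ Nat.gcd 3 M' := Nat.dvd_gcd (dvd_refl 3) h
    rw [h3] at h1
    omega
  obtain ⟨α, β, hαβ⟩ : ∃ α β : ℤ, α * M' + 3 * β = 1 := by
    have hcop : IsCoprime (M' : ℤ) (3 : ℤ) := by
      rw [Int.isCoprime_iff_gcd_eq_one, show (3 : ℤ) = ((3 : ℕ) : ℤ) by rfl, Int.gcd_natCast_natCast]; exact h3.symm
    obtain ⟨u, v, huv⟩ := hcop
    exact ⟨u, v, by linear_combination huv⟩
  have hk0 : k ≠ 0 := by omega
  refine ⟨fun s ↦ (1 / 4 : ℂ) * thetaLFunction (3 * M') (fun x ↦ (conj (q x)) ^ k * Ψ x) s,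
    (differentiable_thetaLFunction (3 * M') _).const_mul _, fun s hs ↦ (hdict s hs).symm, ?_⟩
  -- the regrouped sum and its `3`-integrality
  obtain ⟨s₀, hs₀, hX⟩ := sum_torsion_threeIntegral hk1 hk3 h3' β Ψ hΨint
  set T : ℂ := ∑ b : ZMod M' × ZMod M', Ψ (rep M' b 0) *
        ((kroneckerE₁ ((β : ℂ) * conj ((rep M' b 0 : GaussianInt) : ℂ) / M' + 1 / 3) +
            kroneckerE₁ ((β : ℂ) * conj ((rep M' b 0 : GaussianInt) : ℂ) / M' - 1 / 3)) +
          (-1 : ℂ) ^ k * (kroneckerE₁ ((β : ℂ) * conj ((rep M' b 0 : GaussianInt) : ℂ) / M' + I / 3) +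
            kroneckerE₁ ((β : ℂ) * conj ((rep M' b 0 : GaussianInt) : ℂ) / M' - I / 3)) +
          I ^ k * (kroneckerE₁ ((β : ℂ) * conj ((rep M' b 0 : GaussianInt) : ℂ) / M' + (1 - I) / 3) +
            kroneckerE₁ ((β : ℂ) * conj ((rep M' b 0 : GaussianInt) : ℂ) / M' - (1 - I) / 3)) +
          (-I) ^ k * (kroneckerE₁ ((β : ℂ) * conj ((rep M' b 0 : GaussianInt) : ℂ) / M' + (1 + I) / 3) +
            kroneckerE₁ ((β : ℂ) * conj ((rep M' b 0 : GaussianInt) : ℂ) / M' - (1 + I) / 3))) with hT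
  have hL1 : (1 / 4 : ℂ) * thetaLFunction (3 * M') (fun x ↦ (conj (q x)) ^ k * Ψ x) 1 = (1 / 4 : ℂ) * (((3 * M' : ℕ) : ℂ)⁻¹ * T) := by
    rw [thetaLFunction_one_eq_sum_torsion hq h3 hαβ Ψ hΨ hk0]
  -- the period
  obtain ⟨c, hc0, hcint, hΩ⟩ := exists_imaginaryPeriodRat_quartic hA
  obtain ⟨A₁, hA₁⟩ := hkA
  have hA₁0 : A₁ ≠ 0 := by
    rintro rfl
    rw [mul_zero, Int.natAbs_eq_zero] at hA₁
    exact hA hA₁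
  have hinv := inv_abs_rpow_neg_quarter hA₁
  have hXpos : 0 < |(A : ℝ)| ^ (-(1 / 4 : ℝ)) := Real.rpow_pos_of_pos (abs_pos.mpr (by exact_mod_cast hA)) _
  have hX' : ((((|(A : ℝ)| ^ (-(1 / 4 : ℝ)) : ℝ)) : ℂ)) =
      ((3 : ℂ) ^ ((k : ℂ) / 4) * ((((A₁ : ℝ) ^ (1 / 4 : ℝ) : ℝ)) : ℂ))⁻¹ := by rw [← hinv, inv_inv]
  refine ⟨8 * M' * s₀, ?_, ?_⟩
  · intro h
    rcases (Nat.Prime.dvd_mul Nat.prime_three).mp h with h | h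
    · rcases (Nat.Prime.dvd_mul Nat.prime_three).mp h with h | h
      · omega
      · exact h3' h
    · exact hs₀ h
  show IsIntegral ℤ (((8 * M' * s₀ : ℕ) : ℂ) * (gaussSum χ (ZMod.stdAddChar (N := m)) *
    ((1 / 4 : ℂ) * thetaLFunction (3 * M') (fun x ↦ (conj (q x)) ^ k * Ψ x) 1) /
      (Complex.I * ((⟨0, 0, 0, (A : ℚ), 0⟩ : WeierstrassCurve ℚ).imaginaryPeriodRat : ℂ))))
  rw [hL1, hΩ, Complex.ofReal_mul, Complex.ofReal_mul, hX']
  set ϖ : ℂ := (((Real.Gamma (1 / 4) ^ 2 / (2 * Real.sqrt (2 * Real.pi))) : ℝ) : ℂ) with hϖ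
  set ρ : ℂ := (3 : ℂ) ^ (((4 - k : ℕ) : ℂ) / 4) with hρ
  set t : ℂ := (3 : ℂ) ^ ((k : ℂ) / 4) with ht
  set a : ℂ := ((((A₁ : ℝ) ^ (1 / 4 : ℝ) : ℝ)) : ℂ) with ha
  set τ : ℂ := gaussSum χ (ZMod.stdAddChar (N := m)) with hτ
  have hϖ0 : ϖ ≠ 0 := Complex.ofReal_ne_zero.mpr GaussianLattice.varpi_pos.ne'
  have hρ0 : ρ ≠ 0 := by
    intro h; have := (Complex.cpow_eq_zero_iff _ _).mp h; norm_num at this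
  have ht0 : t ≠ 0 := by
    intro h; have := (Complex.cpow_eq_zero_iff _ _).mp h; norm_num at this
  have ha0 : a ≠ 0 := Complex.ofReal_ne_zero.mpr (Real.rpow_pos_of_pos (by exact_mod_cast Nat.pos_of_ne_zero hA₁0) _).ne'
  have htρ : t * ρ = 3 := cpow_quarter_mul_cpow_quarter (by omega)
  have hcC : (c : ℂ) ≠ 0 := Complex.ofReal_ne_zero.mpr hc0
  have hM : (M' : ℂ) ≠ 0 := Nat.cast_ne_zero.mpr (NeZero.ne M')
  have key : ((8 * M' * s₀ : ℕ) : ℂ) * (τ * ((1 / 4 : ℂ) * (((3 * M' : ℕ) : ℂ)⁻¹ * T)) / (I * ((c : ℂ) * (ϖ * (t * a)⁻¹)))) =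
      (-I) * ((2 : ℂ) / c) * τ * a * ((s₀ : ℂ) * T / (ϖ * ρ)) := by
    push_cast
    field_simp
    linear_combination (8 * (s₀ : ℂ) * τ * T) * htρ + (24 * (s₀ : ℂ) * τ * T) * I_sq
  rw [key]
  have hI : IsIntegral ℤ (-I : ℂ) := by
    refine IsIntegral.of_pow (n := 2) (by norm_num) ?_
    rw [neg_sq, I_sq]; exact isIntegral_one.neg
  exact (((hI.mul hcint).mul (StarredOptimalManinUnitFiveSevenValueExit.isIntegral_gaussSum χ)).mul
    (isIntegral_rpow_quarter A₁)).mul hX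

end Final


end Summit.BirchSwinnertonDyer.BirchSwinnertonDyer.Theorems.InertBadSignedBranchesInertBadAtThreeQuarticCleanAssembly

end
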